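import Literature.NumberTheory.LFunctions.ExplicitZeroFreeRegionKernel
import Literature.NumberTheory.LFunctions.ZetaZeroFreeRegionExplicit
import Literature.NumberTheory.LFunctions.WeilZeroSum

/-!
# Mossinghoff–Trudgian 2015, Theorem 1 ((B₀), `HasOpenClassicalZeroFreeRegion 5.573412`): its reductions

Topic `Literature/NumberTheory/LFunctions`. Sibling PROOF file of `ExplicitZeroFreeRegion.lean` for
(B₀), Theorem 1 of M. J. Mossinghoff, T. S. Trudgian, J. Number Theory 157 (2015) 329–349 =
arXiv:1410.3926: "There are no zeros of `ζ(σ + it)` for `|t| ≥ 2` and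
`σ > 1 − 1/(5.573412 log|t|)`" — in the tree the open-region instance
`HasOpenClassicalZeroFreeRegion 5.573412` of `ExplicitZeroFreeRegionKernel.lean` (D-0026 review of
the decomposition of Thm. 1.3 of Mossinghoff–Trudgian–Yang, 2026-08-15: (B₀) is no longer a
separate named fact (a `Prop`-valued definition), being proved from leaf (A) alone —
`zero_free_region_mossinghoff_trudgian_2015_of_numerical_rh`, `ExplicitZeroFreeRegionRoundsProofs.lean`
— and a corollary of Thm. 1.3; the theorems below accordingly conclude
`HasOpenClassicalZeroFreeRegion 5.573412`, definitionally the printed statement).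
Everything in this file is PROVED (no definition, no named fact).

## Status of (B₀): proved from leaf (A) (`ExplicitZeroFreeRegionRoundsProofs.lean`); what it reduces to, and by which route

The printed proof has two halves of different nature (§§1–3 of the source: "This represents the
largest known zero-free region … for `3.06·10¹⁰ < |t| < exp(10151.5)`"):

1. heights `|t| ≤ T₀ = 3.06·10¹⁰`: the numerical verification of RH to that height ([PlattPi] of
   the source); in the tree subsumed by leaf (A) `platt_trudgian_numerical_rh` (RH to height
   `3 000 175 332 800`), a certified computation without kernel-checkable certificate
   (`RHWave0NumericalRHProofs.lean`) — so EVERY proof of (B₀) goes through (A);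
2. heights `γ₀ > T₀`: Kadiri's method (Acta Arith. 117 (2005), §2) with the degree-16 polynomial
   `F₁₆`, `θ = 1.85573`, `t₀ = 10⁵`, `r = 5`, started from "`R = 5.7`" — admissible because
   Kadiri's region `R₀ = 5.69693` (Kadiri 2005, Thm. 1.1) was already established — seven rounds
   giving `R₀ = 5.5734118005` (§3 of the source). In this file Kadiri's region (B₁) is the
   predicate instance `HasClassicalZeroFreeRegion 5.69693` of `ExplicitZeroFreeRegionInputs.lean`,
   taken as a HYPOTHESIS where the printed architecture uses it and never through a named fact:
   it is a corollary of Theorem 1 itself and of Thm. 1.3 of Mossinghoff–Trudgian–Yang by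
   monotonicity in the constant (`zero_free_region_kadiri_of_mossinghoff_trudgian_2015`,
   `zero_free_region_kadiri_of_mossinghoff_trudgian_yang` there), while on its own it is as hard as
   those theorems (RH verified to `3 330 657 430.697` by Wedeniwski, Kadiri's Props. 2.1–2.6, a
   certified six-round iteration from Rosser–Schoenfeld's `R = 9.645908801`; §2 of the source), so
   it is not separate proof debt (D-0026).

This file records, as theorems, the three honest reductions of (B₀):

* `zero_free_region_mossinghoff_trudgian_2015_of_numerical_rh_of_large_height` — Theorem 1 =
  (A) + its analytic half [no zero `β + iγ` with `γ > T₀` and `β ≥ 1 − 1/(5.573412 log γ)`], for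
  any `1 ≤ T₀ ≤ 3 000 175 332 800`;
* `zero_free_region_mossinghoff_trudgian_2015_of_kadiri_of_kadiriStripEmpty` — the architecture
  AS PRINTED: (A) (used at `T₀ = 3.06·10¹⁰`), Kadiri's region
  `(hB₁ : HasClassicalZeroFreeRegion 5.69693)` as the established region, and the output of
  the seven rounds in the empty-strip form `KadiriStripEmpty (3.06·10¹⁰) 5.573412 5.69693` of
  `ExplicitZeroFreeRegionKernel.lean` (for `r = 5.573412 > 5.5734118005` the master inequality
  (3.1) of the source excludes every zero of the strip);
* `zero_free_region_mossinghoff_trudgian_2015_of_numerical_rh_of_kadiriStripEmpty_chain` — the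
  CYCLE-FREE route: (A) and a chain of empty strips `c 0 → c 1 → ⋯ → c (k+1) ≤ 5.573412` above one
  height `T₀`, ANCHORED AT THE TRIVIAL CONSTANT `c 0 ≤ 0`. Two remarks make the anchor free:
  for `R ≤ 0` the open region `σ > 1 − 1/(R log|t|)` is contained in `σ > 1` and therefore holds
  outright (`hasOpenClassicalZeroFreeRegion_of_nonpos`, Euler product); and `KadiriStripEmpty T₀ r R`
  with `R ≤ 0` is literally "no zero above `T₀` with `β ≥ 1 − 1/(r log γ)`"
  (`kadiriStripEmpty_iff_of_nonpos`): the first link is Kadiri's argument run at points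
  `s = σ + ikγ₀` with `σ ≥ 1`, to the right of all zeros, where no established region is needed
  (in §2 of the source `R` enters only through `σ = 1 − 1/(R log(nγ₀ + t₀))`, which places `s`
  to the right of the zeros near the `s + ikγ₀`, and through `w = (1 − σ)/η` in `K(w, θ)`).

Why the anchor matters for the discharge DAG. In the tree (B₀) is simultaneously the INPUT region
of the iteration behind leaf (B) `zero_free_region_mossinghoff_trudgian_yang_large_height`
(`zero_free_region_mossinghoff_trudgian_yang_large_height_of_mt2015`, the start `R₀ = 5.573412` of
Mossinghoff–Trudgian–Yang §9) and a COROLLARY of (A) + (B)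
(`zero_free_region_mossinghoff_trudgian_2015_of_mossinghoff_trudgian_yang` with
`zero_free_region_mossinghoff_trudgian_yang_of_numerical_rh`). Both implications are theorems, but
one closed proof term cannot use both: discharging (B) through `_of_mt2015` and (B₀) through (B)
would be circular. The literature's own chain (B₀) ⇐ (B₁) ⇐ Rosser–Schoenfeld `9.645908801` ⇐ ⋯ ⇐
de la Vallée Poussin `30.4679` (Table 1 of the source) bottoms out in a region proved without any
previously established one; in the tree the corresponding bottom is the chain below started at
`c 0 = 0`, best run at `T₀ = 3·10¹²` (the largest verified height gives the best constant per
round), each link `KadiriStripEmpty T₀ (c (i+1)) (c i)` being one certified round of the method.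

A PROVED POSITIVE ANCHOR (last section of this file). The first link of a chain started at
`c 0 = 0` is Kadiri's argument at abscissae `σ ≥ 1`, whereas the tree's master inequality
(`KadiriMaster.master_ineq`, `KadiriMasterInequality.lean`) is set up, as in the sources, at
`1/2 < σ < 1` to the right of every zero near the heights `kγ₀`, which needs an established region
with a POSITIVE constant there. Such a region is PROVED in the tree —
`riemannZeta_one_sub_re_ge_explicit` (`ZetaZeroFreeRegionExplicit.lean`, Montgomery–Vaughan's
Theorem 6.6 with explicit constants): every zero `β + it` with `|t| ≥ T ≥ 5` has
`1 − β ≥ 1/((4480 + 74172/log T) log|t|)` — and with leaf (A) below `T` it is the open classical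
region with constant `4480 + 74172/log T`, e.g. `7130` from `T = 3 000 175 332 800`
(`hasOpenClassicalZeroFreeRegion_of_numerical_rh_of_explicit`,
`hasOpenClassicalZeroFreeRegion_anchor_of_numerical_rh`). Hence the cycle-free discharge in which
EVERY link is an ordinary round of the method: (A) and a chain of empty strips
`7130 ≤ c 0 → c 1 → ⋯ → c (k+1)` above one height `T₀ ≤ 3 000 175 332 800`, ending at
`c (k+1) ≤ 5.573412` for (B₀) (`zero_free_region_mossinghoff_trudgian_2015_of_numerical_rh_of_chain`,
`…_of_chain_anchor`) and at `c (k+1) ≤ 5.558691` for Theorem 1.3 of Mossinghoff–Trudgian–Yang and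
its leaf (B) (`zero_free_region_mossinghoff_trudgian_yang_of_numerical_rh_of_chain`,
`zero_free_region_mossinghoff_trudgian_yang_large_height_of_numerical_rh_of_chain`; with rounds that
consume the region they extend, `HasOpenClassicalZeroFreeRegion (c i) → KadiriStripEmpty T₀ (c (i+1)) (c i)`,
the `…_of_rounds` variants). How a round USES the established region `R = c i` is recorded in
the section "Using an established region inside a round": `ζ ≠ 0` at the points `σ + ikγ₀`
(`HasOpenClassicalZeroFreeRegion.riemannZeta_ne_zero_multiple`) and the localisation
`1 − σ ≤ Re ρ ≤ σ` of the zeros near those heights (`HasOpenClassicalZeroFreeRegion.near_bounds`),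
i.e. hypotheses `hζ`, `hζ'`, `hnear` of `KadiriMaster.master_ineq`, from the region, leaf (A) and
`σ ≥ 1 − 1/(R log(Kγ₀ + t₀))`. The size of the
anchor is immaterial: it enters the first round only through `w = (1 − σ)/η`,
`σ = 1 − 1/(c 0 · log(nγ₀ + t₀))`, `η = 1/(r log γ₀)` (§2 of the source), i.e. `w ≈ r/c 0 ≈ 10⁻³`.

## References

* M. J. Mossinghoff, T. S. Trudgian, *Nonnegative trigonometric polynomials and a zero-free region
  for the Riemann zeta-function*, J. Number Theory 157 (2015) 329–349 = arXiv:1410.3926: Thm. 1,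
  §1 (Table 1, the history `30.4679 → ⋯ → 5.69693`), §2 (Kadiri's method, the role of `T₀`, `R`,
  `r`, the iterative procedure), §3 (`T₀ = 3.06·10¹⁰`, `R = 5.7`, `r = 5`, seven rounds,
  `R₀ = 5.5734118005`). (`MossinghoffTrudgian2015`)
* H. Kadiri, *Une région explicite sans zéros pour la fonction ζ de Riemann*, Acta Arith. 117
  (2005) 303–339, Thm. 1.1 and §2.4. (`Kadiri2005`)
* D. J. Platt, T. S. Trudgian, *The Riemann hypothesis is true up to `3·10¹²`*, Bull. Lond. Math.
  Soc. 53 (2021) 792–797, Thm. 1. (`PlattTrudgian2021`)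
* H. L. Montgomery, R. C. Vaughan, *Multiplicative Number Theory I*, CUP 2007, Theorem 6.6
  (explicit form: `ZetaZeroFreeRegionExplicit.lean`). (`MontgomeryVaughan2007`)
-/

noncomputable section

open Complex Real
open scoped ComplexConjugate

namespace Literature.NumberTheory.LFunctions

/-! ## The trivial anchor `R ≤ 0` -/

/-- For `R ≤ 0` the open classical region `σ > 1 − 1/(R log|t|)` (`|t| ≥ 2`) is contained in the
half-plane `σ > 1` (`1/(R log|t|) ≤ 0` since `log|t| > 0`; at `R = 0` Lean's `1/0 = 0` makes it
`σ > 1` exactly), where `ζ ≠ 0` by the Euler product (`riemannZeta_ne_zero_of_one_le_re`). So the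
open-region predicate with a nonpositive constant holds outright: it is the established region of
a first round run "from scratch". [folklore] -/
theorem hasOpenClassicalZeroFreeRegion_of_nonpos {R : ℝ} (hR : R ≤ 0) :
    HasOpenClassicalZeroFreeRegion R := by
  intro σ t ht hσ
  have hlog : 0 < Real.log |t| :=
    (Real.log_pos one_lt_two).trans_le (Real.log_le_log two_pos ht)
  have h1 : 1 / (R * Real.log |t|) ≤ 0 := one_div_nonpos.2 (by nlinarith)
  exact riemannZeta_ne_zero_of_one_le_re (by simp; linarith)

/-- With a nonpositive established constant `R ≤ 0` the empty-strip predicate of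
`ExplicitZeroFreeRegionKernel.lean` carries no a-priori information: every zero `β + iγ` has
`β < 1 ≤ 1 − 1/(R log γ)` (`γ > T₀ ≥ 1`), so `KadiriStripEmpty T₀ r R` says exactly that NO zero
with `γ > T₀` has `β ≥ 1 − 1/(r log γ)` — the closed classical region with constant `r` above the
height `T₀`, with nothing assumed. [folklore] -/
theorem kadiriStripEmpty_iff_of_nonpos {T₀ r R : ℝ} (hR : R ≤ 0) (hT₀ : 1 ≤ T₀) :
    KadiriStripEmpty T₀ r R ↔
      ∀ β γ : ℝ, T₀ < γ → 1 - 1 / (r * Real.log γ) ≤ β → riemannZeta (β + γ * I) ≠ 0 := by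
  constructor
  · intro h β γ hγ hβ hz
    have hlog : 0 < Real.log γ := Real.log_pos (by linarith)
    have h1 : 1 / (R * Real.log γ) ≤ 0 := one_div_nonpos.2 (by nlinarith)
    have hβ1 : β < 1 := by
      by_contra hge
      exact riemannZeta_ne_zero_of_one_le_re (by simp; linarith) hz
    exact h β γ hz hγ hβ (by linarith)
  · intro h β γ hz hγ hβ _
    exact h β γ hγ hβ hz

/-! ## The iteration in empty-strip form, from an arbitrary start -/

/-- **The iterative procedure, empty-strip form** (§2 of the source: "one replaces `R` by this
`R₀` … and performs the computation again"; Kadiri 2005, §2.4). Leaf (A) (RH to a height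
`T₀ ≤ 3 000 175 332 800`), the open region with constant `c 0`, and for each `i < k` the emptiness
of the strip `(T₀, c (i+1), c i)` with `c (i+1) ≥ 2.9` give the open region with constant `c k`
(each round: `HasClassicalZeroFreeRegion.of_kadiriStripEmpty`, then closed ⇒ open).
[cite: MossinghoffTrudgian2015, §2] [cite: Kadiri2005, §2.4] -/
theorem HasOpenClassicalZeroFreeRegion.of_kadiriStripEmpty_chain {T₀ : ℝ} {c : ℕ → ℝ} {k : ℕ}
    (hA : platt_trudgian_numerical_rh) (hT₀ : T₀ ≤ 3000175332800)
    (h0 : HasOpenClassicalZeroFreeRegion (c 0))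
    (hstep : ∀ i < k, KadiriStripEmpty T₀ (c (i + 1)) (c i))
    (hc : ∀ i < k, 2.9 ≤ c (i + 1)) :
    HasOpenClassicalZeroFreeRegion (c k) := by
  induction k with
  | zero => exact h0
  | succ k ih =>
    have hk : HasOpenClassicalZeroFreeRegion (c k) :=
      ih (fun i hi ↦ hstep i (Nat.lt_succ_of_lt hi)) (fun i hi ↦ hc i (Nat.lt_succ_of_lt hi))
    exact (HasClassicalZeroFreeRegion.of_kadiriStripEmpty hA hT₀ hk (hstep k k.lt_succ_self)
      (hc k k.lt_succ_self)).hasOpen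

/-- The same chain with at least one round ends in the CLOSED region with constant `c (k+1)`
(`σ ≥ 1 − 1/(c (k+1) log|t|)`, `|t| ≥ 2`). [cite: MossinghoffTrudgian2015, §2] -/
theorem HasClassicalZeroFreeRegion.of_kadiriStripEmpty_chain {T₀ : ℝ} {c : ℕ → ℝ} {k : ℕ}
    (hA : platt_trudgian_numerical_rh) (hT₀ : T₀ ≤ 3000175332800)
    (h0 : HasOpenClassicalZeroFreeRegion (c 0))
    (hstep : ∀ i < k + 1, KadiriStripEmpty T₀ (c (i + 1)) (c i))
    (hc : ∀ i < k + 1, 2.9 ≤ c (i + 1)) :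
    HasClassicalZeroFreeRegion (c (k + 1)) :=
  HasClassicalZeroFreeRegion.of_kadiriStripEmpty hA hT₀
    (HasOpenClassicalZeroFreeRegion.of_kadiriStripEmpty_chain hA hT₀ h0
      (fun i hi ↦ hstep i (Nat.lt_succ_of_lt hi)) (fun i hi ↦ hc i (Nat.lt_succ_of_lt hi)))
    (hstep k k.lt_succ_self) (hc k k.lt_succ_self)

/-! ## The three reductions of Theorem 1 -/

/-- **(B₀) by the cycle-free route.** Leaf (A), a height `T₀ ≤ 3 000 175 332 800`, and a chain of
empty strips above `T₀` anchored at a trivial constant `c 0 ≤ 0`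
(`hasOpenClassicalZeroFreeRegion_of_nonpos`: nothing is assumed at the start) and ending at
`c (k+1) ≤ 5.573412` give Theorem 1 of Mossinghoff–Trudgian: the chain yields the closed region
with constant `c (k+1)`, a fortiori with `5.573412`, which contains the open region of Theorem 1
(`zero_free_region_mossinghoff_trudgian_2015_of_hasClassicalZeroFreeRegion`). This is the
discharge route of (B₀) that does not pass through leaf (B).
[cite: MossinghoffTrudgian2015, Theorem 1 and §2] -/
theorem zero_free_region_mossinghoff_trudgian_2015_of_numerical_rh_of_kadiriStripEmpty_chain
    {T₀ : ℝ} {c : ℕ → ℝ} {k : ℕ}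
    (hA : platt_trudgian_numerical_rh) (hT₀ : T₀ ≤ 3000175332800) (h0 : c 0 ≤ 0)
    (hstep : ∀ i < k + 1, KadiriStripEmpty T₀ (c (i + 1)) (c i))
    (hc : ∀ i < k + 1, 2.9 ≤ c (i + 1)) (hlast : c (k + 1) ≤ 5.573412) :
    HasOpenClassicalZeroFreeRegion 5.573412 :=
  zero_free_region_mossinghoff_trudgian_2015_of_hasClassicalZeroFreeRegion
    ((HasClassicalZeroFreeRegion.of_kadiriStripEmpty_chain hA hT₀
        (hasOpenClassicalZeroFreeRegion_of_nonpos h0) hstep hc).mono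
      (by linarith [hc k k.lt_succ_self]) hlast)

/-- **Theorem 1 = leaf (A) + its analytic half.** For any height `1 ≤ T₀ ≤ 3 000 175 332 800`:
if no zero `β + iγ` of `ζ` with `γ > T₀` has `β ≥ 1 − 1/(5.573412 log γ)` (the content of §§2–4
of the source above `T₀ = 3.06·10¹⁰`; one empty strip anchored at `R = 0`), then, with RH below
`T₀` from leaf (A) and conjugation for `t < 0`, Theorem 1 holds.
[cite: MossinghoffTrudgian2015, Theorem 1, §1 ("for 3.06·10¹⁰ < |t|") and §3 (T₀ = 3.06·10¹⁰)] -/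
theorem zero_free_region_mossinghoff_trudgian_2015_of_numerical_rh_of_large_height {T₀ : ℝ}
    (hA : platt_trudgian_numerical_rh) (hT₀1 : 1 ≤ T₀) (hT₀ : T₀ ≤ 3000175332800)
    (h : ∀ β γ : ℝ, T₀ < γ → 1 - 1 / (5.573412 * Real.log γ) ≤ β → riemannZeta (β + γ * I) ≠ 0) :
    HasOpenClassicalZeroFreeRegion 5.573412 :=
  zero_free_region_mossinghoff_trudgian_2015_of_hasClassicalZeroFreeRegion
    (HasClassicalZeroFreeRegion.of_kadiriStripEmpty (R := 0) hA hT₀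
      (hasOpenClassicalZeroFreeRegion_of_nonpos le_rfl)
      ((kadiriStripEmpty_iff_of_nonpos le_rfl hT₀1).2 h) (by norm_num))

/-- **The architecture of the printed proof.** Mossinghoff–Trudgian prove Theorem 1 from: RH
verified to `T₀ = 3.06·10¹⁰` ([PlattPi]; here from leaf (A), which verifies more), the region
already established by Kadiri — Théorème 1.1 of Kadiri 2005: `ζ(σ + it) ≠ 0` for `|t| ≥ 2`,
`σ ≥ 1 − 1/(5.69693 log|t|)`, i.e. `HasClassicalZeroFreeRegion 5.69693`, taken here as the
HYPOTHESIS `hB₁` (a corollary of Theorem 1 itself, `zero_free_region_kadiri_of_mossinghoff_trudgian_2015`,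
and of Thm. 1.3 of Mossinghoff–Trudgian–Yang, `zero_free_region_kadiri_of_mossinghoff_trudgian_yang`,
both in `ExplicitZeroFreeRegionInputs.lean`; the source starts from the admissible rounding
`R = 5.7`) — and seven rounds of Kadiri's method with `F₁₆`, `θ = 1.85573`, `t₀ = 10⁵`, `r = 5`,
whose final output `R₀ = 5.5734118005 < 5.573412` empties the strip
`1 − 1/(5.573412 log γ) ≤ β ≤ 1 − 1/(5.69693 log γ)`, `γ > 3.06·10¹⁰` (`KadiriStripEmpty`, the
currency of `ExplicitZeroFreeRegionKernel.lean`). Given those three inputs, Theorem 1 follows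
(closed region with `5.573412`, then the open one). The cycle-free discharge route is
`zero_free_region_mossinghoff_trudgian_2015_of_numerical_rh_of_kadiriStripEmpty_chain` above.
[cite: MossinghoffTrudgian2015, §§2–3 and Theorem 1] [cite: Kadiri2005, Thm. 1.1] -/
theorem zero_free_region_mossinghoff_trudgian_2015_of_kadiri_of_kadiriStripEmpty
    (hA : platt_trudgian_numerical_rh) (hB₁ : HasClassicalZeroFreeRegion 5.69693)
    (h : KadiriStripEmpty 30600000000 5.573412 5.69693) :
    HasOpenClassicalZeroFreeRegion 5.573412 :=
  zero_free_region_mossinghoff_trudgian_2015_of_hasClassicalZeroFreeRegion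
    (HasClassicalZeroFreeRegion.of_kadiriStripEmpty hA (by norm_num) hB₁.hasOpen h (by norm_num))

/-! ## A proved positive anchor, and the chain from it

The established region of the first round need not be conjectural or circular: the tree PROVES a
crude explicit classical region at large height (`riemannZeta_one_sub_re_ge_explicit`), and leaf (A)
covers the small heights. From that anchor every link of the chain is an ordinary round of
Kadiri's method with a positive established constant (`R = c i`, `r = c (i+1)` in the notation of
§2 of the source). -/

/-- **The crude explicit region as an established region.** Leaf (A) (RH to height
`3 000 175 332 800`) and the proved explicit bound `1 − β ≥ 1/((4480 + 74172/log T) log|t|)` for the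
zeros `β + it` with `|t| ≥ T ≥ 5` (`riemannZeta_one_sub_re_ge_explicit`, Montgomery–Vaughan's
Theorem 6.6 made explicit) give the OPEN classical region with every constant
`R ≥ 4480 + 74172/log T`, for each `5 ≤ T ≤ 3 000 175 332 800`: below `T` a zero of the region
would lie on the critical line, which is to the left of the region (`R ≥ 2.9`,
`one_half_lt_of_hasClassicalZeroFreeRegion_hyp`); above `T` the explicit bound excludes it.
[cite: MontgomeryVaughan2007, Theorem 6.6] [cite: PlattTrudgianBLMS2021, Theorem 1] -/
theorem hasOpenClassicalZeroFreeRegion_of_numerical_rh_of_explicit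
    (hA : platt_trudgian_numerical_rh) {T R : ℝ} (h5 : 5 ≤ T) (hT : T ≤ 3000175332800)
    (hR : 4480 + 74172 / Real.log T ≤ R) : HasOpenClassicalZeroFreeRegion R := by
  have hlogT : 0 < Real.log T := Real.log_pos (by linarith)
  have hdiv : 0 ≤ 74172 / Real.log T := div_nonneg (by norm_num) hlogT.le
  have hRT : 0 < 4480 + 74172 / Real.log T := by linarith
  refine forall_abs_of_forall_pos (P := fun σ t ↦ 1 - 1 / (R * Real.log t) < σ) ?_
  intro σ t ht hσ hzero
  have htabs : |t| = t := abs_of_nonneg (by linarith)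
  rcases le_or_gt t T with hsmall | hlarge
  · -- below `T`: the zero is on the critical line, the region lies to its right
    have hre : (σ + t * I : ℂ).re = 1 / 2 :=
      hA (σ + t * I) hzero (by simp; linarith) (by simp; linarith)
    have hR29 : 2.9 ≤ R := by linarith
    have hhalf : 1 / 2 < σ :=
      one_half_lt_of_hasClassicalZeroFreeRegion_hyp (t := t) hR29 (by rwa [htabs])
        (by rw [htabs]; exact hσ.le)
    simp at hre
    linarith
  · -- above `T`: the explicit bound
    have hlogt : 0 < Real.log t := Real.log_pos (by linarith)
    have h1 := riemannZeta_one_sub_re_ge_explicit h5 (by rw [htabs]; exact hlarge.le) hzero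
    rw [htabs] at h1
    have h2 : 1 / (R * Real.log t) ≤ 1 / ((4480 + 74172 / Real.log T) * Real.log t) :=
      one_div_le_one_div_of_le (mul_pos hRT hlogt) (mul_le_mul_of_nonneg_right hR hlogt.le)
    linarith

/-- `log 3 000 175 332 800 ≥ 28`: `e²⁸ = (e¹)²⁸ < 2.7182818286²⁸ < 1.45·10¹² ≤ 3 000 175 332 800`
(`Real.exp_one_lt_d9`). [folklore] -/
theorem le_log_plattTrudgianHeight : (28 : ℝ) ≤ Real.log 3000175332800 := by
  rw [Real.le_log_iff_exp_le (by norm_num)]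
  have h : Real.exp 28 = Real.exp 1 ^ 28 := by exact_mod_cast (Real.exp_one_pow 28).symm
  calc Real.exp 28 = Real.exp 1 ^ 28 := h
    _ ≤ 2.7182818286 ^ 28 := by gcongr; exact Real.exp_one_lt_d9.le
    _ ≤ 3000175332800 := by norm_num

/-- **The anchor at the Platt–Trudgian height.** Leaf (A) alone gives the open classical region
with constant `7130` (`ζ(σ + it) ≠ 0` for `|t| ≥ 2`, `σ > 1 − 1/(7130 log|t|)`): take
`T = 3 000 175 332 800` in `hasOpenClassicalZeroFreeRegion_of_numerical_rh_of_explicit`, where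
`4480 + 74172/log T ≤ 4480 + 74172/28 < 7130`. This is the established region `R` of a first round
of Kadiri's method run without any previously established explicit region.
[cite: MontgomeryVaughan2007, Theorem 6.6] [cite: PlattTrudgianBLMS2021, Theorem 1] -/
theorem hasOpenClassicalZeroFreeRegion_anchor_of_numerical_rh (hA : platt_trudgian_numerical_rh) :
    HasOpenClassicalZeroFreeRegion 7130 := by
  refine hasOpenClassicalZeroFreeRegion_of_numerical_rh_of_explicit hA (T := 3000175332800)
    (by norm_num) le_rfl ?_
  have h1 : (74172 : ℝ) / Real.log 3000175332800 ≤ 74172 / 28 :=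
    div_le_div_of_nonneg_left (by norm_num) (by norm_num) le_log_plattTrudgianHeight
  have h2 : (74172 : ℝ) / 28 ≤ 2650 := by norm_num
  linarith

/-- **(B₀) from leaf (A) and a chain of rounds from an established anchor.** Leaf (A), a height
`T₀ ≤ 3 000 175 332 800`, the open region with constant `c 0` (e.g. the proved anchor `7130`, or
any `c 0 ≤ 0` via `hasOpenClassicalZeroFreeRegion_of_nonpos`), and empty strips
`(T₀, c (i+1), c i)` for `i ≤ k` with `c (i+1) ≥ 2.9` and `c (k+1) ≤ 5.573412` give Theorem 1 of
Mossinghoff–Trudgian (the chain yields the closed region with constant `c (k+1)`, a fortiori with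
`5.573412`, which contains the open region of Theorem 1).
[cite: MossinghoffTrudgian2015, Theorem 1 and §2] [cite: Kadiri2005, §2.4] -/
theorem zero_free_region_mossinghoff_trudgian_2015_of_numerical_rh_of_chain
    {T₀ : ℝ} {c : ℕ → ℝ} {k : ℕ}
    (hA : platt_trudgian_numerical_rh) (hT₀ : T₀ ≤ 3000175332800)
    (h0 : HasOpenClassicalZeroFreeRegion (c 0))
    (hstep : ∀ i < k + 1, KadiriStripEmpty T₀ (c (i + 1)) (c i))
    (hc : ∀ i < k + 1, 2.9 ≤ c (i + 1)) (hlast : c (k + 1) ≤ 5.573412) :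
    HasOpenClassicalZeroFreeRegion 5.573412 :=
  zero_free_region_mossinghoff_trudgian_2015_of_hasClassicalZeroFreeRegion
    ((HasClassicalZeroFreeRegion.of_kadiriStripEmpty_chain hA hT₀ h0 hstep hc).mono
      (by linarith [hc k k.lt_succ_self]) hlast)

/-- **(B₀) from leaf (A) and ordinary rounds only.** As
`zero_free_region_mossinghoff_trudgian_2015_of_numerical_rh_of_chain`, anchored at the PROVED
constant: any `c 0 ≥ 7130` is an established open region by
`hasOpenClassicalZeroFreeRegion_anchor_of_numerical_rh`. The remaining hypotheses are exactly the
certified rounds `KadiriStripEmpty T₀ (c (i+1)) (c i)` of Kadiri's method (§2 of the source with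
`R = c i`, `r = c (i+1)`), the last one reaching `5.573412`; at `T₀ = 3·10¹²` the rounds of
Mossinghoff–Trudgian–Yang §9 pass below it. [cite: MossinghoffTrudgian2015, Theorem 1 and §§2–3]
[cite: MossinghoffTrudgianYangRNT2024, §9] -/
theorem zero_free_region_mossinghoff_trudgian_2015_of_numerical_rh_of_chain_anchor
    {T₀ : ℝ} {c : ℕ → ℝ} {k : ℕ}
    (hA : platt_trudgian_numerical_rh) (hT₀ : T₀ ≤ 3000175332800) (h0 : 7130 ≤ c 0)
    (hstep : ∀ i < k + 1, KadiriStripEmpty T₀ (c (i + 1)) (c i))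
    (hc : ∀ i < k + 1, 2.9 ≤ c (i + 1)) (hlast : c (k + 1) ≤ 5.573412) :
    HasOpenClassicalZeroFreeRegion 5.573412 :=
  zero_free_region_mossinghoff_trudgian_2015_of_numerical_rh_of_chain hA hT₀
    ((hasOpenClassicalZeroFreeRegion_anchor_of_numerical_rh hA).mono (by norm_num) h0) hstep hc hlast

/-- **Theorem 1.3 of Mossinghoff–Trudgian–Yang by the same chain.** Leaf (A), the open region with
constant `c 0`, and empty strips `(T₀, c (i+1), c i)`, `i ≤ k`, ending at `c (k+1) ≤ 5.558691`
give the closed region with constant `5.558691`, which is Theorem 1.3 verbatim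
(`hasClassicalZeroFreeRegion_iff_mossinghoff_trudgian_yang`). With `c 0 ≥ 7130`
(`hasOpenClassicalZeroFreeRegion_anchor_of_numerical_rh`) this is the cycle-free discharge route of
the named fact `zero_free_region_mossinghoff_trudgian_yang` from (A) and certified rounds alone.
[cite: MossinghoffTrudgianYangRNT2024, Theorem 1.3 and §9] -/
theorem zero_free_region_mossinghoff_trudgian_yang_of_numerical_rh_of_chain
    {T₀ : ℝ} {c : ℕ → ℝ} {k : ℕ}
    (hA : platt_trudgian_numerical_rh) (hT₀ : T₀ ≤ 3000175332800)
    (h0 : HasOpenClassicalZeroFreeRegion (c 0))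
    (hstep : ∀ i < k + 1, KadiriStripEmpty T₀ (c (i + 1)) (c i))
    (hc : ∀ i < k + 1, 2.9 ≤ c (i + 1)) (hlast : c (k + 1) ≤ 5.558691) :
    zero_free_region_mossinghoff_trudgian_yang :=
  hasClassicalZeroFreeRegion_iff_mossinghoff_trudgian_yang.1
    ((HasClassicalZeroFreeRegion.of_kadiriStripEmpty_chain hA hT₀ h0 hstep hc).mono
      (by linarith [hc k k.lt_succ_self]) hlast)

/-- **Leaf (B) by the same chain** (through Theorem 1.3,
`zero_free_region_mossinghoff_trudgian_yang_large_height_of`): the cycle-free discharge route of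
(B) that does not take (B₀) as an input (contrast
`zero_free_region_mossinghoff_trudgian_yang_large_height_of_mt2015` of
`ExplicitZeroFreeRegionKernel.lean`). [cite: MossinghoffTrudgianYangRNT2024, Theorem 1.3 and §9] -/
theorem zero_free_region_mossinghoff_trudgian_yang_large_height_of_numerical_rh_of_chain
    {T₀ : ℝ} {c : ℕ → ℝ} {k : ℕ}
    (hA : platt_trudgian_numerical_rh) (hT₀ : T₀ ≤ 3000175332800)
    (h0 : HasOpenClassicalZeroFreeRegion (c 0))
    (hstep : ∀ i < k + 1, KadiriStripEmpty T₀ (c (i + 1)) (c i))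
    (hc : ∀ i < k + 1, 2.9 ≤ c (i + 1)) (hlast : c (k + 1) ≤ 5.558691) :
    zero_free_region_mossinghoff_trudgian_yang_large_height :=
  zero_free_region_mossinghoff_trudgian_yang_large_height_of
    (zero_free_region_mossinghoff_trudgian_yang_of_numerical_rh_of_chain hA hT₀ h0 hstep hc hlast)

/-! ## The chain with rounds that consume the region they extend

A certified round of the method USES the established region `R = c i` (to place `σ < 1` to the
right of the zeros near the heights `kγ₀`; hypothesis `hnear` of `KadiriMaster.master_ineq`) in
order to empty the strip down to `r = c (i+1)`. In the variants below each link is accordingly an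
implication `HasOpenClassicalZeroFreeRegion (c i) → KadiriStripEmpty T₀ (c (i+1)) (c i)`, and the
induction feeds every round the region produced by the previous ones. -/

/-- **The iteration with region-consuming rounds, open form:** leaf (A), a height
`T₀ ≤ 3 000 175 332 800`, the open region with constant `c 0`, and for each `i < k` a round
`HasOpenClassicalZeroFreeRegion (c i) → KadiriStripEmpty T₀ (c (i+1)) (c i)` with `c (i+1) ≥ 2.9`
give the open region with constant `c k`. [cite: MossinghoffTrudgian2015, §2] [cite: Kadiri2005, §2.4] -/
theorem HasOpenClassicalZeroFreeRegion.of_kadiri_rounds {T₀ : ℝ} {c : ℕ → ℝ} {k : ℕ}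
    (hA : platt_trudgian_numerical_rh) (hT₀ : T₀ ≤ 3000175332800)
    (h0 : HasOpenClassicalZeroFreeRegion (c 0))
    (hstep : ∀ i < k, HasOpenClassicalZeroFreeRegion (c i) → KadiriStripEmpty T₀ (c (i + 1)) (c i))
    (hc : ∀ i < k, 2.9 ≤ c (i + 1)) :
    HasOpenClassicalZeroFreeRegion (c k) := by
  induction k with
  | zero => exact h0
  | succ k ih =>
    have hk : HasOpenClassicalZeroFreeRegion (c k) :=
      ih (fun i hi ↦ hstep i (Nat.lt_succ_of_lt hi)) (fun i hi ↦ hc i (Nat.lt_succ_of_lt hi))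
    exact (HasClassicalZeroFreeRegion.of_kadiriStripEmpty hA hT₀ hk
      (hstep k k.lt_succ_self hk) (hc k k.lt_succ_self)).hasOpen

/-- The same with at least one round, ending in the CLOSED region with constant `c (k+1)`.
[cite: MossinghoffTrudgian2015, §2] -/
theorem HasClassicalZeroFreeRegion.of_kadiri_rounds {T₀ : ℝ} {c : ℕ → ℝ} {k : ℕ}
    (hA : platt_trudgian_numerical_rh) (hT₀ : T₀ ≤ 3000175332800)
    (h0 : HasOpenClassicalZeroFreeRegion (c 0))
    (hstep : ∀ i < k + 1,
      HasOpenClassicalZeroFreeRegion (c i) → KadiriStripEmpty T₀ (c (i + 1)) (c i))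
    (hc : ∀ i < k + 1, 2.9 ≤ c (i + 1)) :
    HasClassicalZeroFreeRegion (c (k + 1)) :=
  have hk : HasOpenClassicalZeroFreeRegion (c k) :=
    HasOpenClassicalZeroFreeRegion.of_kadiri_rounds hA hT₀ h0
      (fun i hi ↦ hstep i (Nat.lt_succ_of_lt hi)) (fun i hi ↦ hc i (Nat.lt_succ_of_lt hi))
  HasClassicalZeroFreeRegion.of_kadiriStripEmpty hA hT₀ hk (hstep k k.lt_succ_self hk)
    (hc k k.lt_succ_self)

/-- **(B₀) from leaf (A) and region-consuming rounds** from any established anchor `c 0` (the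
proved `7130` of `hasOpenClassicalZeroFreeRegion_anchor_of_numerical_rh`, say), the last round
reaching `c (k+1) ≤ 5.573412`. This is the form in which certified rounds
`HasOpenClassicalZeroFreeRegion (c i) → KadiriStripEmpty T₀ (c (i+1)) (c i)` assemble into
Theorem 1 of Mossinghoff–Trudgian without unrolling the iteration by hand.
[cite: MossinghoffTrudgian2015, Theorem 1 and §§2–3] -/
theorem zero_free_region_mossinghoff_trudgian_2015_of_numerical_rh_of_rounds
    {T₀ : ℝ} {c : ℕ → ℝ} {k : ℕ}
    (hA : platt_trudgian_numerical_rh) (hT₀ : T₀ ≤ 3000175332800)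
    (h0 : HasOpenClassicalZeroFreeRegion (c 0))
    (hstep : ∀ i < k + 1,
      HasOpenClassicalZeroFreeRegion (c i) → KadiriStripEmpty T₀ (c (i + 1)) (c i))
    (hc : ∀ i < k + 1, 2.9 ≤ c (i + 1)) (hlast : c (k + 1) ≤ 5.573412) :
    HasOpenClassicalZeroFreeRegion 5.573412 :=
  zero_free_region_mossinghoff_trudgian_2015_of_hasClassicalZeroFreeRegion
    ((HasClassicalZeroFreeRegion.of_kadiri_rounds hA hT₀ h0 hstep hc).mono
      (by linarith [hc k k.lt_succ_self]) hlast)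

/-- **Theorem 1.3 of Mossinghoff–Trudgian–Yang from leaf (A) and region-consuming rounds** ending
at `c (k+1) ≤ 5.558691` (hence also its leaf (B), by
`zero_free_region_mossinghoff_trudgian_yang_large_height_of`).
[cite: MossinghoffTrudgianYangRNT2024, Theorem 1.3 and §9] -/
theorem zero_free_region_mossinghoff_trudgian_yang_of_numerical_rh_of_rounds
    {T₀ : ℝ} {c : ℕ → ℝ} {k : ℕ}
    (hA : platt_trudgian_numerical_rh) (hT₀ : T₀ ≤ 3000175332800)
    (h0 : HasOpenClassicalZeroFreeRegion (c 0))
    (hstep : ∀ i < k + 1,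
      HasOpenClassicalZeroFreeRegion (c i) → KadiriStripEmpty T₀ (c (i + 1)) (c i))
    (hc : ∀ i < k + 1, 2.9 ≤ c (i + 1)) (hlast : c (k + 1) ≤ 5.558691) :
    zero_free_region_mossinghoff_trudgian_yang :=
  hasClassicalZeroFreeRegion_iff_mossinghoff_trudgian_yang.1
    ((HasClassicalZeroFreeRegion.of_kadiri_rounds hA hT₀ h0 hstep hc).mono
      (by linarith [hc k k.lt_succ_self]) hlast)

/-! ## Using an established region inside a round (§2 of the source: `σ = 1 − 1/(R log(nγ₀ + t₀))`)

In one round the established region with constant `R` is used at two places (§2 of the source;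
hypotheses `hζ`, `hζ'`, `hnear` of `KadiriMaster.master_ineq`, `KadiriMasterInequality.lean`): the
points `s_k = σ + ikγ₀` (`1 ≤ k ≤ n`) and `s_k + δ` lie inside the region, so `ζ ≠ 0` there (the
real point `s_0 = σ ∈ (1/2, ∞)` is never a zero, `ZetaRealAxis.lean`); and every zero `β + iγ` near
one of the heights `kγ₀`, `k ≤ n` — so that `|γ| < H := nγ₀ + t₀` — satisfies `1 − σ ≤ β ≤ σ` as
soon as `σ ≥ 1 − 1/(R log H)`: by the region for `|γ| ≥ 2`, by leaf (A) for `0 < |γ| < 2` (where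
in fact there is no zero), and by the symmetry `ρ ↦ 1 − ρ̄` of the non-trivial zeros for the
lower bound. -/

/-- **`ζ ≠ 0` strictly inside the region.** Under the open region with constant `R > 0`:
`ζ(σ + it) ≠ 0` whenever `2 ≤ |t| < H` and `σ ≥ 1 − 1/(R log H)` (as `log|t| < log H`, the point
satisfies `σ > 1 − 1/(R log|t|)`). [cite: MossinghoffTrudgian2015, §2] -/
theorem HasOpenClassicalZeroFreeRegion.riemannZeta_ne_zero_of_abs_lt {R H σ t : ℝ}
    (hR : HasOpenClassicalZeroFreeRegion R) (hRpos : 0 < R) (ht : 2 ≤ |t|) (htH : |t| < H)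
    (hσ : 1 - 1 / (R * Real.log H) ≤ σ) : riemannZeta (σ + t * I) ≠ 0 := by
  refine hR σ t ht ?_
  have hlogt : 0 < Real.log |t| := Real.log_pos (by linarith)
  have hlt : Real.log |t| < Real.log H := Real.log_lt_log (by linarith) htH
  have h1 : 1 / (R * Real.log H) < 1 / (R * Real.log |t|) :=
    one_div_lt_one_div_of_lt (mul_pos hRpos hlogt) (mul_lt_mul_of_pos_left hlt hRpos)
  linarith

/-- **Hypotheses `hζ`, `hζ'` of the master inequality from the region.** Under the open region with
constant `R ≥ 2.9`: if `γ₀ ≥ 2`, `t₀ > 0`, `Kγ₀ + t₀ ≥ 2` and `σ ≥ 1 − 1/(R log(Kγ₀ + t₀))`, then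
`ζ(σ + ikγ₀) ≠ 0` for every `k ≤ K` (`k ≥ 1`: the point is strictly inside the region; `k = 0`:
`σ > 1/2` is real and `ζ(σ) ≠ 0` on `[0, 1)` by `riemannZeta_ofReal_ne_zero_of_nonneg_of_lt_one`,
on `[1, ∞)` by the Euler product). Apply with `σ` and with `σ + δ`.
[cite: MossinghoffTrudgian2015, §2] -/
theorem HasOpenClassicalZeroFreeRegion.riemannZeta_ne_zero_multiple {R γ₀ t₀ σ : ℝ} {K : ℕ}
    (hR : HasOpenClassicalZeroFreeRegion R) (hR29 : 2.9 ≤ R) (hγ₀ : 2 ≤ γ₀) (ht₀ : 0 < t₀)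
    (hH : 2 ≤ K * γ₀ + t₀) (hσ : 1 - 1 / (R * Real.log (K * γ₀ + t₀)) ≤ σ) {k : ℕ} (hk : k ≤ K) :
    riemannZeta ((σ : ℂ) + (((k : ℝ) * γ₀ : ℝ) : ℂ) * I) ≠ 0 := by
  rcases Nat.eq_zero_or_pos k with rfl | hk1
  · -- the real point `σ > 1/2`
    have hhalf : 1 / 2 < σ :=
      one_half_lt_of_hasClassicalZeroFreeRegion_hyp (t := K * γ₀ + t₀) hR29
        (by rw [abs_of_nonneg (by linarith)]; exact hH)
        (by rwa [abs_of_nonneg (by linarith : (0 : ℝ) ≤ K * γ₀ + t₀)])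
    have e : ((σ : ℂ) + ((((0 : ℕ) : ℝ) * γ₀ : ℝ) : ℂ) * I) = (σ : ℂ) := by push_cast; ring
    rw [e]
    rcases lt_or_ge σ 1 with h1 | h1
    · exact riemannZeta_ofReal_ne_zero_of_nonneg_of_lt_one (by linarith) h1
    · exact riemannZeta_ne_zero_of_one_le_re (by simpa using h1)
  · -- `k ≥ 1`: strictly inside the region
    have hk1' : (1 : ℝ) ≤ k := by exact_mod_cast hk1
    have hkK : (k : ℝ) ≤ K := by exact_mod_cast hk
    have hkγ : 2 ≤ (k : ℝ) * γ₀ := by nlinarith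
    have habs : |(k : ℝ) * γ₀| = k * γ₀ := abs_of_nonneg (by linarith)
    refine hR.riemannZeta_ne_zero_of_abs_lt (H := K * γ₀ + t₀) (by linarith) (by rw [habs]; exact hkγ)
      (by rw [habs]; nlinarith) hσ

/-- **Localisation of the zeros below height `H`, upper bound.** Under the open region with
constant `R ≥ 2.9` and leaf (A): if `H ≥ 2` and `σ ≥ 1 − 1/(R log H)`, every non-trivial zero `ρ`
with `|Im ρ| < H` has `Re ρ ≤ σ` — for `|Im ρ| ≥ 2` by the region (`Re ρ ≤ 1 − 1/(R log|Im ρ|)` and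
`log|Im ρ| < log H`); for `0 < |Im ρ| < 2` leaf (A) puts `ρ` (or `ρ̄`) on the critical line while
`σ > 1/2`; `Im ρ = 0` does not occur for a non-trivial zero (`ZetaRealAxis.lean`).
[cite: MossinghoffTrudgian2015, §2] [cite: PlattTrudgianBLMS2021, Theorem 1] -/
theorem HasOpenClassicalZeroFreeRegion.re_le_of_abs_im_lt {R H σ : ℝ}
    (hR : HasOpenClassicalZeroFreeRegion R) (hA : platt_trudgian_numerical_rh) (hR29 : 2.9 ≤ R)
    (hH : 2 ≤ H) (hσ : 1 - 1 / (R * Real.log H) ≤ σ) {ρ : ℂ}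
    (hρ : ρ ∈ RHWave0.riemannZetaNontrivialZeros) (hγ : |ρ.im| < H) : ρ.re ≤ σ := by
  have hRpos : 0 < R := by linarith
  have hz : riemannZeta ρ = 0 := ZetaZeros.riemannZetaNontrivialZeros.zeta_eq_zero hρ
  rcases le_or_gt 2 |ρ.im| with h2 | h2
  · -- in the range of the region
    have hz' : riemannZeta ((ρ.re : ℂ) + (ρ.im : ℂ) * I) = 0 := by rwa [Complex.re_add_im]
    have hle := hR.re_le h2 hz'
    have hlog : 0 < Real.log |ρ.im| := Real.log_pos (by linarith)
    have hlt : Real.log |ρ.im| < Real.log H := Real.log_lt_log (by linarith) hγ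
    have h1 : 1 / (R * Real.log H) < 1 / (R * Real.log |ρ.im|) :=
      one_div_lt_one_div_of_lt (mul_pos hRpos hlog) (mul_lt_mul_of_pos_left hlt hRpos)
    linarith
  · -- `0 < |Im ρ| < 2`: on the critical line by leaf (A), and `σ > 1/2`
    have hhalf : 1 / 2 < σ :=
      one_half_lt_of_hasClassicalZeroFreeRegion_hyp (t := H) hR29
        (by rw [abs_of_nonneg (by linarith)]; exact hH)
        (by rwa [abs_of_nonneg (by linarith : (0 : ℝ) ≤ H)])
    have him : ρ.im ≠ 0 := ZetaZeros.riemannZetaNontrivialZeros.im_ne_zero hρ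
    have h2' := abs_lt.1 h2
    have hre : ρ.re = 1 / 2 := by
      rcases lt_or_gt_of_ne him with hneg | hpos
      · have hc := hA (conj ρ) (by rw [riemannZeta_conj, hz, map_zero])
          (by simp only [Complex.conj_im]; linarith) (by simp only [Complex.conj_im]; linarith)
        simpa using hc
      · exact hA ρ hz hpos (by linarith)
    linarith

/-- **Localisation, two-sided (hypothesis `hnear` of the master inequality at one height).** Under
the open region with constant `R ≥ 2.9` and leaf (A): if `H ≥ 2` and `σ ≥ 1 − 1/(R log H)`, every
non-trivial zero `ρ` with `|Im ρ| < H` satisfies `1 − σ ≤ Re ρ ≤ σ` (the lower bound is the upper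
one for the non-trivial zero `1 − ρ̄`, which has the same imaginary part).
[cite: MossinghoffTrudgian2015, §2] [cite: Kadiri2005, §3] -/
theorem HasOpenClassicalZeroFreeRegion.near_bounds_of_abs_im_lt {R H σ : ℝ}
    (hR : HasOpenClassicalZeroFreeRegion R) (hA : platt_trudgian_numerical_rh) (hR29 : 2.9 ≤ R)
    (hH : 2 ≤ H) (hσ : 1 - 1 / (R * Real.log H) ≤ σ) {ρ : ℂ}
    (hρ : ρ ∈ RHWave0.riemannZetaNontrivialZeros) (hγ : |ρ.im| < H) :
    1 - σ ≤ ρ.re ∧ ρ.re ≤ σ := by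
  refine ⟨?_, hR.re_le_of_abs_im_lt hA hR29 hH hσ hρ hγ⟩
  have hρ' : 1 - conj ρ ∈ RHWave0.riemannZetaNontrivialZeros :=
    ZetaZeros.riemannZetaNontrivialZeros.one_sub_conj_mem hρ
  have h := hR.re_le_of_abs_im_lt hA hR29 hH hσ hρ' (by simpa using hγ)
  simp only [Complex.sub_re, Complex.one_re, Complex.conj_re] at h
  linarith

/-- **Hypothesis `hnear` of `KadiriMaster.master_ineq` from the region** (the choice
`σ ≥ 1 − 1/(R log(Kγ₀ + t₀))` of §2 of the source): under the open region with constant `R ≥ 2.9`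
and leaf (A), with `γ₀ ≥ 0` and `Kγ₀ + t₀ ≥ 2`, for every `k ≤ K` every non-trivial zero `ρ` with
`|Im ρ − kγ₀| < t₀` (so `|Im ρ| < Kγ₀ + t₀`) satisfies `1 − σ ≤ Re ρ ≤ σ`.
[cite: MossinghoffTrudgian2015, §2] [cite: Kadiri2005, §3] -/
theorem HasOpenClassicalZeroFreeRegion.near_bounds {R γ₀ t₀ σ : ℝ} {K : ℕ}
    (hR : HasOpenClassicalZeroFreeRegion R) (hA : platt_trudgian_numerical_rh) (hR29 : 2.9 ≤ R)
    (hγ₀ : 0 ≤ γ₀) (hH : 2 ≤ K * γ₀ + t₀) (hσ : 1 - 1 / (R * Real.log (K * γ₀ + t₀)) ≤ σ)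
    {k : ℕ} (hk : k ≤ K) {ρ : ℂ} (hρ : ρ ∈ RHWave0.riemannZetaNontrivialZeros)
    (hnearρ : |ρ.im - k * γ₀| < t₀) : 1 - σ ≤ ρ.re ∧ ρ.re ≤ σ := by
  refine hR.near_bounds_of_abs_im_lt hA hR29 hH hσ hρ ?_
  have hkK : (k : ℝ) * γ₀ ≤ K * γ₀ := mul_le_mul_of_nonneg_right (by exact_mod_cast hk) hγ₀
  have hk0 : 0 ≤ (k : ℝ) * γ₀ := mul_nonneg (by positivity) hγ₀
  have h := abs_lt.1 hnearρ
  rw [abs_lt]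
  constructor <;> linarith

end Literature.NumberTheory.LFunctions
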